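import Summits.BirchSwinnertonDyer.Rank1Residual.Additive.GordCycLowerBound
import Summits.BirchSwinnertonDyer.Rank1Residual.X1.RankOneParitySqueeze
import Literature.NumberTheory.EllipticCurves.IwasawaLeadingTermProofs
import Literature.NumberTheory.EllipticCurves.CyclotomicIwasawaMainTheoremIrreducibleProofs
import HarnessLib

/-!
# O7-ord, rank one: a λ-CERTIFICATE discharges Delbourgo's Schneider rider and bounds `Ш` from BELOW
# by ONE `p`-adic regulator valuation (cell `b2b-bsdres`, team n1011, seat p01, OWNERS row T-O7, step 1b)

HONEST FRAMING (cell `b2b-bsdres`, run/shared/lean/b2b/bsd-rank1-residual/, verbatim in every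
file): prove what is provable now; shrink each hard class to its core with data; no claim beyond
stated classes. Research routes; census output = EVIDENCE / conjecture items, never a Literature
fact; RESIDUAL-MAP marks change only by signed lines. §I O7 stays OPEN; nothing is booked; no label
changes. ONE definition (a CERTIFICATE-SHAPED typed input, nothing asserted) and theorems; the
published input Delbourgo, J. Number Theory 95 (2002) Thm. (B) enters only through its clause
predicate `Delbourgo2002.LeadingTermClauses W p Dh` (A175's, explicit binder; no `_holds`).
COVERAGE GAP (referee 1 proviso, stated first): the only tree source of those clauses, A175
`Delbourgo2002.mainTheorem`, covers `p ≥ 5`, potentially GOOD ordinary, non-CM curves — whereas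
O7-ord's bulk is `p = 3` (X4 r = 1 @3: 10 677 of 11 602 cells) and the potentially multiplicative
rows; both are inside the PRINTED Hypothesis of the paper (p. 39) but await A175's `TODO(general
form)`; every theorem below is stated against the clause predicate and applies verbatim to such an
extension. The Schneider rider of RESIDUAL-MAP §I O7-ord is NOT discharged numerically here (rmap-2
g7's certificate stays EVIDENCE): it is DERIVED from another explicit, certificate-shaped binder
(`CharLamLeAt`, below) by a kernel implication — one typed per-pair input replaces another.

## What and why

RESIDUAL-MAP §I O7-ord names, besides X_D1 and the Disegni↔Delbourgo comparison, the per-pair rider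
"Schneider non-degeneracy of `⟨,⟩_{p,ℚ}`" — the hypothesis of Delbourgo 2002 Thm. (B) under which the
algebraic leading term of `X(E/ℚ_∞)` has order EXACTLY `r_E` and the printed value; rmap-2 g7
certified it NUMERICALLY on 11 505 / 11 505 pairs (EVIDENCE, not kernel). Delbourgo's Thm. (C)
(`L_p^{alg}` divides the `Δ`-fixed branch of `L_p^{an}` in `ℤ_p⟦G⟧[μ_p, p⁻¹]` — a RATIONAL divisibility,
so it bounds the `λ`-invariant of a generator `fE` of `char_Λ X(E/ℚ_∞)` by that of the analytic
function and says nothing about `μ`) turns ONE finite computation — `λ(L_p^{an}) ≤ r_E` on the branch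
(defect 2: the `ε`-branch of the Mazur–Tate–Teitelbaum measure of the semistable twist `E♭`; ttrl
instruments I-2/I-4) — into the algebraic statement typed here:

* `CharLamLeAt W p n` (§0, certificate-shaped, nothing asserted): every generator `fE` of
  `char_Λ X(E/ℚ_∞)` (cyclotomic data as in `CycLowerBoundAt`) has `λ(fE) ≤ n`.

With `n = r = rank_ℤ E(ℚ)` and the clauses of Thm. (B) for a height datum `Dh` (intended:
Delbourgo's `⟨,⟩_{p,ℚ}`), this file PROVES (no conjecture involved):

* §1 `order_eq_rank_of_charLamLe`: `ord_{T=0} fE = r` (clause 1 gives `≥`, `ord_T ≤ λ ≤ r` gives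
  `≤`); hence (clause 2) **`schneider_and_finite_of_charLamLe`: `Reg_p(E,Dh) ≠ 0` AND `#Ш(E/ℚ)[p^∞] < ∞`**
  — the rider is DISCHARGED by the λ-certificate (and `Ш[p^∞]` finite comes for free, without GZK).
* §2 `padicVal_identity_of_charLamLe`: then `λ(fE) = r`, `[T^r]fE = p^{μ(fE)}·(unit)`
  (`valuation_coeff_lam`), `log_p(γ_cyc) = p·(unit)` for odd `p`, and clause 3 reads
  **`ord_p #Ш(E) + ord_p Reg_p(E,Dh) + ord_p ∏c_ℓ + ord_p ℓ = μ(fE) + r + 2·ord_p #E(ℚ)_tors`**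
  (`ℓ ∣ p²` Delbourgo's factor, `= 1` off the anomalous rows); dropping `μ(fE) ≥ 0`:
  `ord_p #Ш(E) ≥ r + 2·ord_p #tors − ord_p Reg_p − ord_p ∏c_ℓ − ord_p ℓ` — a LOWER bound on `Ш` from
  ONE computed valuation `ord_p Reg_p(E, ⟨,⟩_{p,ℚ})` (rmap-2's engines A/B/C give the height value).
* §3 `missingLowerBoundAt_of_charLamLe_of_regulatorCertificate`: with `#Ш_an = s` and the per-pair
  inequality `ord_p Reg_p(Dh) + ord_p s + ord_p ∏c_ℓ ≤ r + 2·ord_p #tors` (non-anomalous rows), the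
  LOWER half `Typed.MissingLowerBoundAt W p` — the rank-one counterpart, at an ADDITIVE potentially
  ordinary prime, of the cell's λ-minimal levers (`X2/RankOneRegulatorBSD.lean`,
  `X9/IwasawaLowerBoundRankOne.lean`); it complements additive-p1's Heegner-index certificates
  (UPPER half, `AdditivePotMult/RankOneShaCertificate.lean`). And `missingLowerBoundAt_of_cycLowerBound_of_charLamLe`:
  the class-level route of `GordCycLowerBound.lean` with the Schneider binder REPLACED by the certificate.

Scope: any `W` with `LeadingTermClauses W p Dh` and torsion `X` — A175 supplies both on Delbourgo's
(G)-ordinary cell at `p ≥ 5`, non-CM (class wrappers in `GordCycLowerBoundClass.lean` style are one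
line each and left to the consumer); `p ≠ 2` for `ord_p log_p(γ_cyc) = 1`. What is NOT claimed: the
certificate itself (Delbourgo (C) and the analytic function are not tree objects — A175's TODO), any
`μ`-statement, any booking.

References: [Delbourgo2002] Thm. (B), (C) (p. 40), p. 39; [Washington1997] §7.1 (λ, μ, distinguished
polynomials); [BalakrishnanMullerStein2015] Thm. 1.7 (shape); [Miller2011LMS] Def. 1.1;
[SteinWuthrich2013] §4 (certificates of this kind at good ordinary `p`).
-/

noncomputable section

open scoped Classical NumberField

open WeierstrassCurve NumberField PowerSeries Literature.NumberTheory.EllipticCurves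
  Literature.NumberTheory.EllipticCurves.Rank1Residual
  Literature.NumberTheory.EllipticCurves.Rank1Residual.Typed
  Literature.NumberTheory.EllipticCurves.Delbourgo2002
  Summit.BirchSwinnertonDyer.Rank1Residual.X1.MuLambda
  Summit.BirchSwinnertonDyer.Rank1Residual.X1.RankOneParitySqueeze
  IsDedekindDomain

namespace Summit.BirchSwinnertonDyer.Rank1Residual.Additive

/-! ### §0 The certificate-shaped typed input: `λ(char_Λ X(E/ℚ_∞)) ≤ n` -/

/-- **TYPED INPUT (certificate-shaped; nothing asserted): `λ(char_Λ X(E/ℚ_∞)) ≤ n`.** For the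
cyclotomic `ℤ_p`-extension `κ` with a topological generator `γ` matching the cyclotomic variable,
EVERY Pontryagin-dual datum `D` of `Sel_{p^∞}(E/ℚ_∞)` and EVERY generator `fE` of `char_Λ X(E/ℚ_∞)`
have Iwasawa `λ`-invariant `λ(fE) ≤ n`. Intended discharge, per pair, with `n = rank E(ℚ)`: Delbourgo
2002 Thm. (C) (`L_p^{alg} ∣ L_p^{an}|_Δ` in `ℤ_p⟦G⟧[μ_p, p⁻¹]`, hence `λ(fE) ≤ λ(L_p^{an}|_Δ)`) and the
finite computation `λ(L_p^{an}|_Δ) = n` — neither object is in the tree (A175's `TODO(general form)`),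
so this is a typed per-pair input, not a theorem. A predicate on `(W, p, n)`.
[cite: Delbourgo2002, Theorem (C) (p. 40) (shape of the intended discharge; nothing asserted)]
[cite: Washington1997, §7.1 (λ-invariant of a power series)] -/
def CharLamLeAt (W : WeierstrassCurve ℚ) [W.IsElliptic] (p : ℕ) [Fact p.Prime] (n : ℕ) : Prop :=
  ∀ (κ : ZpExtension ℚ p) (γ : Field.absoluteGaloisGroup ℚ),
    κ.IsCyclotomic → κ.IsTopGenerator γ → IsCyclotomicVariable p γ →
    ∀ (D : W.SelmerDualData κ γ) (fE : IwasawaAlgebra p), D.charIdeal = Ideal.span {fE} → lam fE ≤ n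

/-- Unfolding lemma for `CharLamLeAt`. -/
theorem charLamLeAt_iff (W : WeierstrassCurve ℚ) [W.IsElliptic] (p : ℕ) [Fact p.Prime] (n : ℕ) :
    CharLamLeAt W p n ↔
      ∀ (κ : ZpExtension ℚ p) (γ : Field.absoluteGaloisGroup ℚ),
        κ.IsCyclotomic → κ.IsTopGenerator γ → IsCyclotomicVariable p γ →
        ∀ (D : W.SelmerDualData κ γ) (fE : IwasawaAlgebra p), D.charIdeal = Ideal.span {fE} →
          lam fE ≤ n :=
  Iff.rfl

variable (W : WeierstrassCurve ℚ) [W.IsElliptic] (p : ℕ) [hp : Fact p.Prime]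

/-! ### §1 `ord_T fE = rank` and the Schneider rider from the λ-certificate -/

omit [W.IsElliptic] in
/-- A generator of the characteristic ideal of `X(E/ℚ_∞)` is non-zero (`char_Λ` of any module over a
domain is a non-zero ideal, `Module.charIdeal_ne_bot`). [folklore] -/
theorem generator_ne_zero_of_charIdeal_eq {κ : ZpExtension ℚ p} {γ : Field.absoluteGaloisGroup ℚ}
    (D : W.SelmerDualData κ γ) {fE : IwasawaAlgebra p} (hchar : D.charIdeal = Ideal.span {fE}) :
    fE ≠ 0 := by
  intro h0
  refine Module.charIdeal_ne_bot (IwasawaAlgebra p) D.X ?_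
  change D.charIdeal = ⊥
  rw [hchar, h0]
  exact Ideal.span_singleton_eq_bot.mpr rfl

omit [W.IsElliptic] in
/-- **`ord_{T=0} fE = rank_ℤ E(ℚ)` from the λ-certificate.** Clause 1 of Delbourgo 2002 (B) gives
`r ≤ ord_T fE`; for `fE ≠ 0`, `ord_T fE ≤ λ(fE)` (`order_le_lam`) and the certificate `λ(fE) ≤ r` give
`≤`. [cite: Delbourgo2002, Theorem (B) (p. 40)] [cite: Washington1997, §7.1] -/
theorem order_eq_rank_of_charLamLe {Dh : PAdicHeightData W p} (hB : LeadingTermClauses W p Dh)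
    {κ : ZpExtension ℚ p} {γ : Field.absoluteGaloisGroup ℚ}
    (hκ : κ.IsCyclotomic) (hγ : κ.IsTopGenerator γ) (hγ' : IsCyclotomicVariable p γ)
    (D : W.SelmerDualData κ γ) [Module.Finite (IwasawaAlgebra p) D.X] (hX : D.IsTorsion)
    {fE : IwasawaAlgebra p} (hchar : D.charIdeal = Ideal.span {fE})
    (hlam : lam fE ≤ W.mordellWeilRank) : fE.order = W.mordellWeilRank := by
  have hf0 : fE ≠ 0 := generator_ne_zero_of_charIdeal_eq W p D hchar
  refine le_antisymm ?_ (hB κ γ hκ hγ hγ' D hX fE hchar).1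
  exact (order_le_lam hf0).trans (by exact_mod_cast hlam)

/-- **The λ-certificate DISCHARGES the Schneider rider (and gives `#Ш[p^∞] < ∞`).** If Delbourgo 2002
(B) holds for the height datum `Dh` (`hB`), `X(E/ℚ_∞)` is torsion for every datum (`hA`, shape of
Thm. (A)) and `λ(fE) ≤ rank_ℤ E(ℚ)` for every cyclotomic datum and generator (`CharLamLeAt`), then
`ord_T fE = rank`, so clause 2 of (B) yields `Reg_p(E,Dh) ≠ 0` and `Ш(E/ℚ)[p^∞]` finite.
[cite: Delbourgo2002, Theorem (A), (B) (p. 40)] -/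
theorem schneider_and_finite_of_charLamLe {Dh : PAdicHeightData W p} (hB : LeadingTermClauses W p Dh)
    (hA : ∀ (κ : ZpExtension ℚ p) (γ : Field.absoluteGaloisGroup ℚ),
      κ.IsCyclotomic → κ.IsTopGenerator γ → ∀ D : W.SelmerDualData κ γ, D.IsTorsion)
    (hlam : CharLamLeAt W p W.mordellWeilRank) :
    SchneiderConjecture Dh ∧ Finite (AddCommGroup.primaryComponent W.sha p) := by
  obtain ⟨κ, hκ, γ, hγ, hγ'⟩ := exists_isCyclotomic_isTopGenerator_isCyclotomicVariable_holds p
  obtain ⟨D⟩ := W.nonempty_selmerDualData_holds κ γ hγ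
  haveI : Module.Finite (IwasawaAlgebra p) D.X := D.module_finite_holds hγ
  haveI : (Module.charIdeal (IwasawaAlgebra p) D.X).IsPrincipal := charIdeal_isPrincipal_holds p D.X
  obtain ⟨fE, hchar⟩ := Submodule.IsPrincipal.principal (Module.charIdeal (IwasawaAlgebra p) D.X)
  have hchar' : D.charIdeal = Ideal.span {fE} := hchar
  have hX : D.IsTorsion := hA κ γ hκ hγ D
  have hord := order_eq_rank_of_charLamLe W p hB hκ hγ hγ' D hX hchar'
    (hlam κ γ hκ hγ hγ' D fE hchar')
  exact (hB κ γ hκ hγ hγ' D hX fE hchar').2.1.mp hord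

/-! ### §2 The exact valuation identity: `ord_p #Ш + ord_p Reg_p + ord_p ∏c + ord_p ℓ = μ(fE) + r + 2 ord_p #tors` -/

/-- **The valuation identity at a λ-certified pair.** Setting: `p ≠ 2`, Delbourgo 2002 (B) for `Dh`
(`hB`), a cyclotomic datum `D` with `X` torsion and generator `fE`, `λ(fE) ≤ r = rank_ℤ E(ℚ)`. Then
`λ(fE) = r`, `ord_T fE = r`, Schneider and finiteness hold (§1), `[T^r] fE = p^{μ(fE)} · unit`
(`valuation_coeff_lam`), `log_p γ_cyc = p · unit`, and clause 3 of (B) gives, in `ℤ`: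
`ord_p #Ш(E)[p^∞] + ord_p Reg_p(E,Dh) + ord_p ∏c_ℓ + ord_p ℓ = μ(fE) + r + 2·ord_p #E(ℚ)_tors`, with
Delbourgo's `ℓ ∣ p²` (`= 1` off the anomalous rows); no finiteness of `Ш` or GZK is assumed — the
finiteness of `Ш[p^∞]` is part of the conclusion. [cite: Delbourgo2002, Theorem (B) (p. 40)]
[cite: Washington1997, §7.1] -/
theorem padicVal_identity_of_charLamLe {Dh : PAdicHeightData W p} (hB : LeadingTermClauses W p Dh)
    (hp2 : p ≠ 2) {κ : ZpExtension ℚ p} {γ : Field.absoluteGaloisGroup ℚ}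
    (hκ : κ.IsCyclotomic) (hγ : κ.IsTopGenerator γ) (hγ' : IsCyclotomicVariable p γ)
    (D : W.SelmerDualData κ γ) [Module.Finite (IwasawaAlgebra p) D.X] (hX : D.IsTorsion)
    {fE : IwasawaAlgebra p} (hchar : D.charIdeal = Ideal.span {fE})
    (hlam : lam fE ≤ W.mordellWeilRank) :
    SchneiderConjecture Dh ∧ Finite (AddCommGroup.primaryComponent W.sha p) ∧ lam fE = W.mordellWeilRank ∧
    ∃ ℓ : ℕ, ℓ ∣ p ^ 2 ∧ (ReductionNonAnomalous W p → ℓ = 1) ∧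
      (padicValNat p (Nat.card (AddCommGroup.primaryComponent W.sha p)) : ℤ) +
          (padicRegulator Dh).valuation + padicValNat p W.tamagawaProduct + padicValNat p ℓ =
        mu fE + W.mordellWeilRank + 2 * padicValNat p W.torsionOrder := by
  have hpP : p.Prime := hp.out
  have hf0 : fE ≠ 0 := generator_ne_zero_of_charIdeal_eq W p D hchar
  have hord : fE.order = W.mordellWeilRank := order_eq_rank_of_charLamLe W p hB hκ hγ hγ' D hX hchar hlam
  obtain ⟨hS, hfin⟩ := (hB κ γ hκ hγ hγ' D hX fE hchar).2.1.mp hord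
  -- `λ(fE) = r`
  have hlamr : lam fE = W.mordellWeilRank := by
    refine le_antisymm hlam ?_
    have h := order_le_lam hf0
    rw [hord] at h
    exact_mod_cast h
  -- clause 3
  obtain ⟨u, ℓ, hℓp, hℓ1, heq⟩ := (hB κ γ hκ hγ hγ' D hX fE hchar).2.2 hS hfin
  refine ⟨hS, hfin, hlamr, ℓ, hℓp, hℓ1, ?_⟩
  -- the pieces and their valuations
  set r := W.mordellWeilRank with hr_def
  obtain ⟨hcoef0, hcoefv⟩ := valuation_coeff_lam hf0
  rw [hlamr] at hcoef0 hcoefv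
  obtain ⟨w, hw⟩ := exists_unit_padicLog_cyclotomicGenerator (p := p) hp2
  have hpQ : (p : ℚ_[p]) ≠ 0 := by exact_mod_cast hpP.ne_zero
  have hlog0 : padicLog p (cyclotomicGenerator p : ℚ_[p]) ≠ 0 := by
    rw [hw]; exact mul_ne_zero hpQ (coe_units_ne_zero p w)
  have hlogv : (padicLog p (cyclotomicGenerator p : ℚ_[p])).valuation = 1 := by
    rw [hw, Padic.valuation_mul hpQ (coe_units_ne_zero p w), Padic.valuation_p,
      valuation_coe_units_eq_zero, add_zero]
  have hT0 : W.torsionOrder ≠ 0 := (W.torsionOrder_pos_holds).ne'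
  have hTQ : (W.torsionOrder : ℚ_[p]) ≠ 0 := by exact_mod_cast hT0
  have hu0 : ((u : ℤ_[p]) : ℚ_[p]) ≠ 0 := coe_units_ne_zero p u
  have hℓ0 : ℓ ≠ 0 := by
    rintro rfl
    exact hpP.ne_zero (pow_eq_zero_iff (n := 2) (by norm_num) |>.mp (zero_dvd_iff.mp hℓp))
  have hℓQ : (ℓ : ℚ_[p]) ≠ 0 := by exact_mod_cast hℓ0
  haveI : Finite (AddCommGroup.primaryComponent W.sha p) := hfin
  have hShp0 : (Nat.card (AddCommGroup.primaryComponent W.sha p) : ℚ_[p]) ≠ 0 := by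
    exact_mod_cast Nat.card_pos.ne'
  have hRg0 : padicRegulator Dh ≠ 0 := hS
  have hCc0 : (W.tamagawaProduct : ℚ_[p]) ≠ 0 := by
    exact_mod_cast (W.tamagawaProduct_pos_holds : 0 < W.tamagawaProduct).ne'
  -- valuations of both sides of clause 3
  have hL : (((PowerSeries.coeff r fE : ℤ_[p]) : ℚ_[p]) *
        padicLog p (cyclotomicGenerator p) ^ r * (W.torsionOrder : ℚ_[p]) ^ 2).valuation =
      (mu fE : ℤ) + r + 2 * (padicValNat p W.torsionOrder : ℤ) := by
    rw [Padic.valuation_mul (mul_ne_zero hcoef0 (pow_ne_zero _ hlog0)) (pow_ne_zero 2 hTQ),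
      Padic.valuation_mul hcoef0 (pow_ne_zero _ hlog0), Padic.valuation_pow, Padic.valuation_pow,
      hcoefv, hlogv, Padic.valuation_natCast]
    push_cast
    ring
  have hR : (((u : ℤ_[p]) : ℚ_[p]) * (ℓ : ℚ_[p]) *
        ((Nat.card (AddCommGroup.primaryComponent W.sha p) : ℚ_[p]) * padicRegulator Dh *
          (W.tamagawaProduct : ℚ_[p]))).valuation =
      (padicValNat p ℓ : ℤ) +
        ((padicValNat p (Nat.card (AddCommGroup.primaryComponent W.sha p)) : ℤ) +
          (padicRegulator Dh).valuation + padicValNat p W.tamagawaProduct) := by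
    rw [Padic.valuation_mul (mul_ne_zero hu0 hℓQ) (mul_ne_zero (mul_ne_zero hShp0 hRg0) hCc0),
      Padic.valuation_mul hu0 hℓQ, valuation_coe_units_eq_zero, zero_add, Padic.valuation_natCast,
      Padic.valuation_mul (mul_ne_zero hShp0 hRg0) hCc0, Padic.valuation_mul hShp0 hRg0,
      Padic.valuation_natCast, Padic.valuation_natCast]
  have hval := congrArg Padic.valuation heq
  rw [hL, hR] at hval
  linarith

/-- **The LOWER bound on `Ш[p^∞]` from ONE regulator valuation (non-anomalous rows).** In the
setting of `padicVal_identity_of_charLamLe` with `ReductionNonAnomalous W p` (`ℓ = 1`), dropping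
`μ(fE) ≥ 0`: `Ш(E/ℚ)[p^∞]` is finite and
`rank + 2·ord_p #tors ≤ ord_p #Ш(E)[p^∞] + ord_p Reg_p(E,Dh) + ord_p ∏c_ℓ`.
[cite: Delbourgo2002, Theorem (B) (p. 40)] [cite: Washington1997, §7.1] -/
theorem rank_add_le_padicVal_of_charLamLe {Dh : PAdicHeightData W p} (hB : LeadingTermClauses W p Dh)
    (hA : ∀ (κ : ZpExtension ℚ p) (γ : Field.absoluteGaloisGroup ℚ),
      κ.IsCyclotomic → κ.IsTopGenerator γ → ∀ D : W.SelmerDualData κ γ, D.IsTorsion)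
    (hp2 : p ≠ 2) (hna : ReductionNonAnomalous W p) (hlam : CharLamLeAt W p W.mordellWeilRank) :
    Finite (AddCommGroup.primaryComponent W.sha p) ∧
    (W.mordellWeilRank : ℤ) + 2 * padicValNat p W.torsionOrder ≤
      (padicValNat p (Nat.card (AddCommGroup.primaryComponent W.sha p)) : ℤ) +
        (padicRegulator Dh).valuation + padicValNat p W.tamagawaProduct := by
  obtain ⟨κ, hκ, γ, hγ, hγ'⟩ := exists_isCyclotomic_isTopGenerator_isCyclotomicVariable_holds p
  obtain ⟨D⟩ := W.nonempty_selmerDualData_holds κ γ hγ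
  haveI : Module.Finite (IwasawaAlgebra p) D.X := D.module_finite_holds hγ
  haveI : (Module.charIdeal (IwasawaAlgebra p) D.X).IsPrincipal := charIdeal_isPrincipal_holds p D.X
  obtain ⟨fE, hchar⟩ := Submodule.IsPrincipal.principal (Module.charIdeal (IwasawaAlgebra p) D.X)
  have hchar' : D.charIdeal = Ideal.span {fE} := hchar
  obtain ⟨-, hfin, -, ℓ, -, hℓ1, hid⟩ := padicVal_identity_of_charLamLe W p hB hp2 hκ hγ hγ' D
    (hA κ γ hκ hγ D) hchar' (hlam κ γ hκ hγ hγ' D fE hchar')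
  rw [hℓ1 hna, padicValNat_one_right, Nat.cast_zero, add_zero] at hid
  have hmu : (0 : ℤ) ≤ (mu fE : ℤ) := by exact_mod_cast Nat.zero_le _
  exact ⟨hfin, by linarith⟩

/-! ### §3 The per-pair LOWER-half certificate and the class route without the Schneider binder -/

/-- **Per-pair LOWER half from the λ-certificate and ONE regulator valuation.** Let `p ≠ 2`, Delbourgo
2002 (B) hold for `Dh` (`hB`), `X` torsion (`hA`), the reduction non-anomalous, `λ(fE) ≤ rank` for
every cyclotomic datum (`CharLamLeAt`), `r_an ≤ 1` with Gross–Zagier–Kolyvagin (`hGZK`, only to know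
that ALL of `Ш(E/ℚ)` is finite, so that `ord_p #Ш[p^∞] = ord_p #Ш`), `#Ш(E)_an = s ∈ ℚ` (`hs`), and
suppose the computed numbers satisfy
`ord_p Reg_p(E,Dh) + ord_p s + ord_p ∏c_ℓ ≤ rank + 2·ord_p #E(ℚ)_tors` (`hcert`: for Delbourgo's height
this is the BSD-predicted value of `ord_p Reg_p` when `μ = 0`). Then `Typed.MissingLowerBoundAt W p`.
[cite: Delbourgo2002, Theorem (B) (p. 40)] [cite: Miller2011LMS, Def. 1.1] -/
theorem missingLowerBoundAt_of_charLamLe_of_regulatorCertificate {Dh : PAdicHeightData W p}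
    (hB : LeadingTermClauses W p Dh)
    (hA : ∀ (κ : ZpExtension ℚ p) (γ : Field.absoluteGaloisGroup ℚ),
      κ.IsCyclotomic → κ.IsTopGenerator γ → ∀ D : W.SelmerDualData κ γ, D.IsTorsion)
    (hGZK : rank_eq_analyticRank_of_analyticRank_le_one) (hr : W.analyticRank ≤ 1)
    (hp2 : p ≠ 2) (hna : ReductionNonAnomalous W p) (hlam : CharLamLeAt W p W.mordellWeilRank)
    {s : ℚ} (hs : shaAn W = (s : ℂ))
    (hcert : (padicRegulator Dh).valuation + padicValRat p s + padicValNat p W.tamagawaProduct ≤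
      (W.mordellWeilRank : ℤ) + 2 * padicValNat p W.torsionOrder) :
    MissingLowerBoundAt W p := by
  obtain ⟨-, hfinSha⟩ := hGZK W hr
  haveI : Finite W.sha := hfinSha
  obtain ⟨-, h⟩ := rank_add_le_padicVal_of_charLamLe W p hB hA hp2 hna hlam
  rw [padicValNat_card_addPrimaryComponent] at h
  refine ⟨s, hs, ?_⟩
  rw [WeierstrassCurve.shaOrder]
  linarith

/-- **The class route of `GordCycLowerBound.lean` WITHOUT the Schneider binder.** The typed lower input
`CycLowerBoundAt W p Dh` + Delbourgo 2002 (B) for `Dh` + (A)-torsion + GZK + `r_an ≤ 1` + non-anomalous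
give `Typed.MissingLowerBoundAt W p`, the rider `Reg_p(Dh) ≠ 0` being DISCHARGED by the λ-certificate
`CharLamLeAt W p (rank E(ℚ))` (`schneider_and_finite_of_charLamLe`).
[cite: Delbourgo2002, Theorem (A), (B), (C) (p. 40)] [cite: Miller2011LMS, Def. 1.1] -/
theorem missingLowerBoundAt_of_cycLowerBound_of_charLamLe {Dh : PAdicHeightData W p}
    (hB : LeadingTermClauses W p Dh)
    (hA : ∀ (κ : ZpExtension ℚ p) (γ : Field.absoluteGaloisGroup ℚ),
      κ.IsCyclotomic → κ.IsTopGenerator γ → ∀ D : W.SelmerDualData κ γ, D.IsTorsion)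
    (hGZK : rank_eq_analyticRank_of_analyticRank_le_one) (hr : W.analyticRank ≤ 1)
    (hna : ReductionNonAnomalous W p) (hlam : CharLamLeAt W p W.mordellWeilRank)
    (hlow : CycLowerBoundAt W p Dh) : MissingLowerBoundAt W p :=
  missingLowerBoundAt_of_cycLowerBound W p hB (schneider_and_finite_of_charLamLe W p hB hA hlam).1 hA
    hGZK hr hna hlow

end Summit.BirchSwinnertonDyer.Rank1Residual.Additive

end
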